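import Summits.QuantumFields.YangMills.Theorems.LuscherReductionTwistedTraceScalingBOStiffFlatImage
import Summits.QuantumFields.YangMills.Theorems.LuscherReductionTwistedTraceScalingBOStiffFlatTransfer
import Summits.QuantumFields.YangMills.Theorems.LuscherReductionTwistedTraceScalingBOStiffFlatModel
import Summits.QuantumFields.YangMills.Theorems.LuscherReductionTwistedTraceScalingBOStiffJumpFloor
import HarnessLib

/-!
# (B-ST) the bridge, concrete half I: THE FLAT MODEL PUSHED FORWARD TO THE BALANCED FIBRE — `hflat` for the flat measure `ν_β = vol ∘ flatMap_β⁻¹` on `cS β` with the TRUE door data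
# `(cD, cΘ·cK·cΘ'·Z_ν/I_ν)` (lane A of S-BASE, crux `TwistedTraceScaling` stmt-QuantumFields-20203, C4-CORE, the (B-ST) pen, lead g22; HANDOFF-g22.md §PLAN TO CLOSE hflat (3))

At a fixed `β ≥ 1`, given the action-to-Hessian bound `η` on `cS β` (✓`eventually_action_hessian_cS`) and admissible core data `(ρ, R, t, u)` with the two exit-mass smallness conditions of
✓`flat_model_selfNormalised`, ★★★ `hflat_pushforward`: for every bounded measurable `g` vanishing off `cS β`,
`Var_{cS}^{cD,ν}(g) ≤ e^{4η}·(2/(1−ρ))·½∫_{cS}∫_{cS} (g x − g y)²·cΘ(x)cK(x,y)cΘ(y)·(Z_ν/I_ν) dν dν + (2/(1−ρ))(ε_S + ε_R)·∫_{cS} g²cD dν`,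
`ν = Measure.map (flatMap β) volume`, `Z_ν = ∫_{cS} cD dν`, `I_ν = ∫_{cS}∫_{cS} cΘcKcΘ' dν dν` (assumed `> 0`; the lead's `…BOStiffFlatBridge` gets it from `cIk > 0`).
Chain: ✓`flat_model_selfNormalised` (σ = StiffIdx β, E = ↥gaugeModes, a = flatA, b = flatB, γ = flatScale, s = β⁻¹, S = flatMap⁻¹(cS) by ✓`preimage_flatMap_cS`) → ✓`flat_kernel_change`
(`D₁ = cD∘flatMap = (N̄/vacCoef²)·D₀` by ✓`cD_flatMap`; `G₀ ≤ vacCoef²e^{2η}·G₁`, `G₁ ≤ (e^{2η}/vacCoef²)·G₀` by ✓`kernel_flatMap_two_sided`) → ✓`hflat_map_of_pullback`.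
HONEST FRAMING: bookkeeping for a stub of a child of the CONDITIONAL route R2b1; (B-ST) OPEN; C4-CORE OPEN; not infinite volume, not a gap, not Clay.  No named facts, no `sorry`.
-/

set_option autoImplicit false

noncomputable section

open MeasureTheory Filter
open scoped BigOperators RealInnerProductSpace ENNReal
open Literature.MathematicalPhysics.QuantumFieldTheory Literature.MathematicalPhysics.QuantumLattice

namespace Summit.QuantumFields.YangMills.Theorems.FemtoTransferGap.TwoLattice.ConstTube

open Summit.QuantumFields.YangMills.Theorems.FemtoTransferGap
open TwoLattice TwoLattice.Stiff TwoLattice.Cov TwoLattice.GnChart TwoLattice.Toron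
open Summit.QuantumFields.YangMills.Theorems.FemtoTransferGap.Mehler (hR mehlerKernel)
open Literature.Analysis.SegalBargmann (vacCoef vacCoef_pos)

variable {L : ℕ} [NeZero L]

/-- The flat coordinate space carries an additive Haar `volume` (product of Lebesgue on `ℝ^σ` and on the inner-product space `↥gaugeModes`). [folklore] -/
theorem isAddHaarMeasure_volume_flat (β : ℝ) : (volume : Measure ((StiffIdx L β → ℝ) × gaugeModes L)).IsAddHaarMeasure :=
  Measure.prod.instIsAddHaarMeasure (volume : Measure (StiffIdx L β → ℝ)) (volume : Measure (gaugeModes L))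

/-- `flatMap β` is a measurable embedding (`β > 0`). [folklore] -/
theorem measurableEmbedding_flatMap {β : ℝ} (hβ : 0 < β) : MeasurableEmbedding (flatMap L β : ((StiffIdx L β → ℝ) × gaugeModes L) → (Edge 3 L → Fin 3 → ℝ)) :=
  measurableEmbedding_of_injective_linear L (flatMap_injective hβ)

/-- The flat kernel `G₀(p,q) = h₀(y)K(y,y')h₀(y')·e^{−‖z‖²/s²}e^{−‖z'‖²/s²}` is jointly measurable, positive and `≤ vacCoef²` (`β > 0`). [folklore] -/
theorem flatKernel_data {β : ℝ} (hβ : 0 < β) (s : ℝ) :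
    Measurable (Function.uncurry fun p q : (StiffIdx L β → ℝ) × gaugeModes L =>
      hR 0 p.1 * mehlerKernel (flatA L β) (flatB L β) p.1 q.1 * hR 0 q.1 * (Real.exp (-(‖p.2‖ ^ 2 / s ^ 2)) * Real.exp (-(‖q.2‖ ^ 2 / s ^ 2)))) ∧
    (∀ p q : (StiffIdx L β → ℝ) × gaugeModes L,
      0 < hR 0 p.1 * mehlerKernel (flatA L β) (flatB L β) p.1 q.1 * hR 0 q.1 * (Real.exp (-(‖p.2‖ ^ 2 / s ^ 2)) * Real.exp (-(‖q.2‖ ^ 2 / s ^ 2)))) ∧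
    (∀ p q : (StiffIdx L β → ℝ) × gaugeModes L,
      |hR 0 p.1 * mehlerKernel (flatA L β) (flatB L β) p.1 q.1 * hR 0 q.1 * (Real.exp (-(‖p.2‖ ^ 2 / s ^ 2)) * Real.exp (-(‖q.2‖ ^ 2 / s ^ 2)))| ≤
        vacCoef (StiffIdx L β) ^ 2) := by
  have hc1 : Continuous (hR (0 : StiffIdx L β →₀ ℕ) : (StiffIdx L β → ℝ) → ℝ) := Mehler.continuous_hR_zero
  have hc2 : Continuous fun p : (StiffIdx L β → ℝ) × (StiffIdx L β → ℝ) => mehlerKernel (flatA L β) (flatB L β) p.1 p.2 := Mehler.continuous_mehlerKernel_uncurry _ _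
  refine ⟨?_, fun p q => ?_, fun p q => ?_⟩
  · have hm1 : Measurable (hR (0 : StiffIdx L β →₀ ℕ) : (StiffIdx L β → ℝ) → ℝ) := hc1.measurable
    have hm2 : Measurable fun p : (StiffIdx L β → ℝ) × (StiffIdx L β → ℝ) => mehlerKernel (flatA L β) (flatB L β) p.1 p.2 := hc2.measurable
    have m1 : Measurable fun pq : ((StiffIdx L β → ℝ) × gaugeModes L) × ((StiffIdx L β → ℝ) × gaugeModes L) => hR 0 pq.1.1 :=
      hm1.comp measurable_fst.fst
    have mf : Measurable fun pq : ((StiffIdx L β → ℝ) × gaugeModes L) × ((StiffIdx L β → ℝ) × gaugeModes L) => (pq.1.1, pq.2.1) :=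
      measurable_fst.fst.prodMk measurable_snd.fst
    have m2 := hm2.comp mf
    have m3 : Measurable fun pq : ((StiffIdx L β → ℝ) × gaugeModes L) × ((StiffIdx L β → ℝ) × gaugeModes L) => hR 0 pq.2.1 :=
      hm1.comp measurable_snd.fst
    have m4 : Measurable fun pq : ((StiffIdx L β → ℝ) × gaugeModes L) × ((StiffIdx L β → ℝ) × gaugeModes L) => Real.exp (-(‖pq.1.2‖ ^ 2 / s ^ 2)) :=
      Real.measurable_exp.comp ((measurable_fst.snd.norm.pow_const 2).div_const _).neg
    have m5 : Measurable fun pq : ((StiffIdx L β → ℝ) × gaugeModes L) × ((StiffIdx L β → ℝ) × gaugeModes L) => Real.exp (-(‖pq.2.2‖ ^ 2 / s ^ 2)) :=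
      Real.measurable_exp.comp ((measurable_snd.snd.norm.pow_const 2).div_const _).neg
    exact ((m1.mul m2).mul m3).mul (m4.mul m5)
  · have h1 := (Mehler.hR_zero_pos_le (σ := StiffIdx L β) p.1).1
    have h2 := (Mehler.hR_zero_pos_le (σ := StiffIdx L β) q.1).1
    have h3 := Mehler.mehlerKernel_pos (flatA L β) (flatB L β) p.1 q.1
    exact mul_pos (mul_pos (mul_pos h1 h3) h2) (mul_pos (Real.exp_pos _) (Real.exp_pos _))
  · obtain ⟨h1, h1'⟩ := Mehler.hR_zero_pos_le (σ := StiffIdx L β) p.1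
    obtain ⟨h2, h2'⟩ := Mehler.hR_zero_pos_le (σ := StiffIdx L β) q.1
    have h3 := Mehler.mehlerKernel_pos (flatA L β) (flatB L β) p.1 q.1
    have h3' := Mehler.mehlerKernel_le_one (fun k => (flatA_sq_add (L := L) hβ k).1.le) (fun k => (flatA_sq_add (L := L) hβ k).2.1.le) p.1 q.1
    have h4 : Real.exp (-(‖p.2‖ ^ 2 / s ^ 2)) ≤ 1 := Real.exp_le_one_iff.2 (neg_nonpos.2 (div_nonneg (sq_nonneg _) (sq_nonneg _)))
    have h5 : Real.exp (-(‖q.2‖ ^ 2 / s ^ 2)) ≤ 1 := Real.exp_le_one_iff.2 (neg_nonpos.2 (div_nonneg (sq_nonneg _) (sq_nonneg _)))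
    have hvc := (vacCoef_pos (σ := StiffIdx L β)).le
    rw [abs_of_pos (mul_pos (mul_pos (mul_pos h1 h3) h2) (mul_pos (Real.exp_pos _) (Real.exp_pos _)))]
    calc hR 0 p.1 * mehlerKernel (flatA L β) (flatB L β) p.1 q.1 * hR 0 q.1 * (Real.exp (-(‖p.2‖ ^ 2 / s ^ 2)) * Real.exp (-(‖q.2‖ ^ 2 / s ^ 2)))
        ≤ vacCoef (StiffIdx L β) * 1 * vacCoef (StiffIdx L β) * (1 * 1) :=
          mul_le_mul (mul_le_mul (mul_le_mul h1' h3' h3.le hvc) h2' h2.le (mul_nonneg hvc zero_le_one))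
            (mul_le_mul h4 h5 (Real.exp_pos _).le zero_le_one) (mul_nonneg (Real.exp_pos _).le (Real.exp_pos _).le)
            (mul_nonneg (mul_nonneg hvc zero_le_one) hvc)
      _ = vacCoef (StiffIdx L β) ^ 2 := by ring

/-- The pulled-back true kernel `G₁(p,q) = cΘ(Tp)·cK(Tp,Tq)·cΘ(Tq)` is jointly measurable, non-negative and `≤ 1` (`β ≥ 0`). [folklore] -/
theorem trueKernel_flat_data {β : ℝ} (hβ : 0 ≤ β) :
    Measurable (Function.uncurry fun p q : (StiffIdx L β → ℝ) × gaugeModes L => cΘ L β (flatMap L β p) * cK L β (flatMap L β p) (flatMap L β q) * cΘ L β (flatMap L β q)) ∧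
    (∀ p q : (StiffIdx L β → ℝ) × gaugeModes L, 0 ≤ cΘ L β (flatMap L β p) * cK L β (flatMap L β p) (flatMap L β q) * cΘ L β (flatMap L β q)) ∧
    (∀ p q : (StiffIdx L β → ℝ) × gaugeModes L, |cΘ L β (flatMap L β p) * cK L β (flatMap L β p) (flatMap L β q) * cΘ L β (flatMap L β q)| ≤ 1) := by
  have hTm : Measurable (flatMap L β : ((StiffIdx L β → ℝ) × gaugeModes L) → (Edge 3 L → Fin 3 → ℝ)) := (LinearMap.continuous_of_finiteDimensional _).measurable
  obtain ⟨hΘm, hΘb, hΘ0⟩ := cΘ_data (L := L) β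
  refine ⟨?_, fun p q => ?_, fun p q => ?_⟩
  · have mT1 : Measurable fun pq : ((StiffIdx L β → ℝ) × gaugeModes L) × ((StiffIdx L β → ℝ) × gaugeModes L) => flatMap L β pq.1 := hTm.comp measurable_fst
    have mT2 : Measurable fun pq : ((StiffIdx L β → ℝ) × gaugeModes L) × ((StiffIdx L β → ℝ) × gaugeModes L) => flatMap L β pq.2 := hTm.comp measurable_snd
    have m1 := hΘm.comp mT1
    have m2 := (measurable_cK (L := L) β).comp (mT1.prodMk mT2)
    have m3 := hΘm.comp mT2
    exact (m1.mul m2).mul m3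
  · exact mul_nonneg (mul_nonneg (hΘ0 _) (cK_pos_le_one hβ _ _).1.le) (hΘ0 _)
  · rw [abs_of_nonneg (mul_nonneg (mul_nonneg (hΘ0 _) (cK_pos_le_one hβ _ _).1.le) (hΘ0 _))]
    have h1 := hΘb (flatMap L β p); have h2 := hΘb (flatMap L β q)
    rw [abs_of_nonneg (hΘ0 _)] at h1 h2
    calc cΘ L β (flatMap L β p) * cK L β (flatMap L β p) (flatMap L β q) * cΘ L β (flatMap L β q) ≤ 1 * 1 * 1 :=
          mul_le_mul (mul_le_mul h1 (cK_pos_le_one hβ _ _).2 (cK_pos_le_one hβ _ _).1.le zero_le_one) h2 (hΘ0 _) (by norm_num)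
      _ = 1 := by ring

/-- The true kernel `cΘ·cK·cΘ'` on the fibre is jointly measurable, non-negative, `≤ 1`, and vanishes off `cS × cS` (`β ≥ 0`). [folklore] -/
theorem trueKernel_data {β : ℝ} (hβ : 0 ≤ β) :
    Measurable (Function.uncurry fun x y : Edge 3 L → Fin 3 → ℝ => cΘ L β x * cK L β x y * cΘ L β y) ∧
    (∀ x y : Edge 3 L → Fin 3 → ℝ, 0 ≤ cΘ L β x * cK L β x y * cΘ L β y) ∧ (∀ x y : Edge 3 L → Fin 3 → ℝ, |cΘ L β x * cK L β x y * cΘ L β y| ≤ 1) ∧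
    (∀ x y : Edge 3 L → Fin 3 → ℝ, cΘ L β x * cK L β x y * cΘ L β y ≠ 0 → x ∈ cS L β ∧ y ∈ cS L β) := by
  obtain ⟨hΘm, hΘb, hΘ0⟩ := cΘ_data (L := L) β
  refine ⟨((hΘm.comp measurable_fst).mul (measurable_cK (L := L) β)).mul (hΘm.comp measurable_snd), fun x y => ?_, fun x y => ?_, fun x y h => ?_⟩
  · exact mul_nonneg (mul_nonneg (hΘ0 _) (cK_pos_le_one hβ _ _).1.le) (hΘ0 _)
  · rw [abs_of_nonneg (mul_nonneg (mul_nonneg (hΘ0 _) (cK_pos_le_one hβ _ _).1.le) (hΘ0 _))]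
    have h1 := hΘb x; have h2 := hΘb y
    rw [abs_of_nonneg (hΘ0 _)] at h1 h2
    calc cΘ L β x * cK L β x y * cΘ L β y ≤ 1 * 1 * 1 :=
          mul_le_mul (mul_le_mul h1 (cK_pos_le_one hβ _ _).2 (cK_pos_le_one hβ _ _).1.le zero_le_one) h2 (hΘ0 _) (by norm_num)
      _ = 1 := by ring
  · constructor
    · intro hx; exact h (by rw [show cΘ L β x = 0 from hx]; ring)
    · intro hy; exact h (by rw [show cΘ L β y = 0 from hy]; ring)

omit [NeZero L] in
/-- `a·e·(f·(G/a)) = G` when `e·f = 1`, `a ≠ 0`. [folklore] -/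
theorem kernel_sandwich_aux {a e f G : ℝ} (ha : a ≠ 0) (hef : e * f = 1) : a * e * (f * (G / a)) = G := by
  rw [show a * e * (f * (G / a)) = (e * f) * (a * G / a) by ring, hef, one_mul, mul_div_cancel_left₀ _ ha]

omit [NeZero L] in
/-- `e·(G/a) = (e/a)·G`. [folklore] -/
theorem kernel_sandwich_aux' {a e G : ℝ} : e * (G / a) = e / a * G := by ring

/-- ★★★ **THE FLAT MODEL PUSHED FORWARD TO THE BALANCED FIBRE.**  Fix `β ≥ 1`, the action-to-Hessian bound `η` on `cS β`, a β-free contraction bound `ρ ∈ [0,1)` for the modes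
(`b̃_k/(ã_k+b̃_k+π) ≤ ρ`), and core data `R > 0`, `t ≥ 0`, `u` with `r(β) ≤ γ_k R`, `(ρr + t√Σγ²)² + u² ≤ r(β)²` and the two exit-mass smallness conditions (`≤ 1/4`); let
`ν = Measure.map (flatMap β) volume` and assume `I_ν = ∫_{cS}∫_{cS} cΘcKcΘ' dν dν > 0`.  Then for every bounded measurable `g` vanishing off `cS β`:
`∫_{cS} g²cD dν − (∫_{cS} g cD dν)²/∫_{cS} cD dν ≤ (vacCoef²e^{2η}·(e^{2η}/vacCoef²)·2/(1−ρ))·½∫_{cS}∫_{cS}(g x − g y)²·(cΘ(x)cK(x,y)cΘ(y)·(Z_ν/I_ν)) dν dν + (2/(1−ρ))(ε_S+ε_R)·∫_{cS} g²cD dν`.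
[cite: Wipf2021, §8.5.1 (8.56)–(8.58)] -/
theorem hflat_pushforward {β : ℝ} (hβ1 : 1 ≤ β) {η : ℝ}
    (hη : ∀ y ∈ cS L β, |β / 2 * wilsonAction su2Rep (orthoTube L 1 y) - ⟪linkEmbed L y, ((β / 2) • stiffHessian L) (linkEmbed L y)⟫| ≤ η)
    {ρ : ℝ} (hρ0 : 0 ≤ ρ) (hρ : ∀ k : StiffIdx L β, flatB L β k / (flatA L β k + flatB L β k + Real.pi) ≤ ρ) (hρ1 : ρ < 1)
    {R t u : ℝ} (hRpos : 0 < R) (hRr : ∀ k : StiffIdx L β, min (1 / 40) (powScale (1 / 2) β * btLog β) ≤ flatScale L β k * R) (ht : 0 ≤ t)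
    (hfit : (ρ * min (1 / 40) (powScale (1 / 2) β * btLog β) + t * Real.sqrt (∑ k, flatScale L β k ^ 2)) ^ 2 + u ^ 2 ≤ (min (1 / 40) (powScale (1 / 2) β * btLog β)) ^ 2)
    (hεR : 2 * Fintype.card (StiffIdx L β) * Real.exp (-(Real.pi * ((1 - ρ) * R) ^ 2)) ≤ 1 / 4)
    (hεS : 2 * Fintype.card (StiffIdx L β) * Real.exp (-(Real.pi * t ^ 2)) +
      (∫ z in (Metric.closedBall (0 : gaugeModes L) u)ᶜ ∩ Metric.closedBall (0 : gaugeModes L) (min (1 / 40) (powScale (1 / 2) β * btLog β)),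
          Real.exp (-(‖z‖ ^ 2 / powScale 1 β ^ 2))) /
        (∫ z in Metric.closedBall (0 : gaugeModes L) (min (1 / 40) (powScale (1 / 2) β * btLog β)), Real.exp (-(‖z‖ ^ 2 / powScale 1 β ^ 2))) ≤ 1 / 4)
    (hIν : 0 < ∫ x in cS L β, ∫ y in cS L β, cΘ L β x * cK L β x y * cΘ L β y ∂(Measure.map (flatMap L β) volume) ∂(Measure.map (flatMap L β) volume))
    {g : (Edge 3 L → Fin 3 → ℝ) → ℝ} (hg : Measurable g) {Cg : ℝ} (hgb : ∀ x, |g x| ≤ Cg) (hgS : ∀ x, x ∉ cS L β → g x = 0) :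
    (∫ x in cS L β, g x ^ 2 * cD L β x ∂(Measure.map (flatMap L β) volume)) -
        (∫ x in cS L β, g x * cD L β x ∂(Measure.map (flatMap L β) volume)) ^ 2 / (∫ x in cS L β, cD L β x ∂(Measure.map (flatMap L β) volume)) ≤
      (vacCoef (StiffIdx L β) ^ 2 * Real.exp (2 * η) * (Real.exp (2 * η) / vacCoef (StiffIdx L β) ^ 2) * (2 / (1 - ρ))) *
          ((1 / 2) * ∫ x in cS L β, ∫ y in cS L β, (g x - g y) ^ 2 * (cΘ L β x * cK L β x y * cΘ L β y *
            ((∫ z in cS L β, cD L β z ∂(Measure.map (flatMap L β) volume)) /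
              ∫ z in cS L β, ∫ w in cS L β, cΘ L β z * cK L β z w * cΘ L β w ∂(Measure.map (flatMap L β) volume) ∂(Measure.map (flatMap L β) volume)))
            ∂(Measure.map (flatMap L β) volume) ∂(Measure.map (flatMap L β) volume)) +
        (2 / (1 - ρ) * (2 * Fintype.card (StiffIdx L β) * Real.exp (-(Real.pi * t ^ 2)) +
              (∫ z in (Metric.closedBall (0 : gaugeModes L) u)ᶜ ∩ Metric.closedBall (0 : gaugeModes L) (min (1 / 40) (powScale (1 / 2) β * btLog β)),
                  Real.exp (-(‖z‖ ^ 2 / powScale 1 β ^ 2))) /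
                (∫ z in Metric.closedBall (0 : gaugeModes L) (min (1 / 40) (powScale (1 / 2) β * btLog β)), Real.exp (-(‖z‖ ^ 2 / powScale 1 β ^ 2))) +
            2 * Fintype.card (StiffIdx L β) * Real.exp (-(Real.pi * ((1 - ρ) * R) ^ 2)))) *
          ∫ x in cS L β, g x ^ 2 * cD L β x ∂(Measure.map (flatMap L β) volume) := by
  have hβ : 0 < β := by linarith
  -- abbreviations
  set V := (StiffIdx L β → ℝ) × gaugeModes L
  set T : V →ₗ[ℝ] (Edge 3 L → Fin 3 → ℝ) := flatMap L β with hT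
  set r : ℝ := min (1 / 40) (powScale (1 / 2) β * btLog β) with hr
  set S : Set V := {p : V | ∑ k, flatScale L β k ^ 2 * p.1 k ^ 2 + ‖p.2‖ ^ 2 ≤ r ^ 2} with hSdef
  have hTm : Measurable (T : V → (Edge 3 L → Fin 3 → ℝ)) := (LinearMap.continuous_of_finiteDimensional _).measurable
  have hTemb : MeasurableEmbedding (T : V → (Edge 3 L → Fin 3 → ℝ)) := measurableEmbedding_flatMap (L := L) hβ
  have hpre : (T : V → (Edge 3 L → Fin 3 → ℝ)) ⁻¹' cS L β = S := by rw [hT, hSdef, hr]; exact preimage_flatMap_cS (L := L) β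
  have hmem : ∀ p : V, p ∈ S ↔ T p ∈ cS L β := fun p => by rw [← hpre]; rfl
  -- Mehler data
  have ha : ∀ k, 0 < flatA L β k := fun k => (flatA_sq_add (L := L) hβ k).1
  have hb : ∀ k, 0 < flatB L β k := fun k => (flatA_sq_add (L := L) hβ k).2.1
  have hab : ∀ k, flatA L β k ^ 2 + 2 * flatA L β k * flatB L β k = Real.pi ^ 2 := fun k => (flatA_sq_add (L := L) hβ k).2.2
  have hγ : ∀ k, 0 < flatScale L β k := fun k => (flatScale_pos_sq (L := L) hβ k).1
  have hr0 : 0 < r := lt_min (by norm_num) (mul_pos (powScale_pos _ _) (lt_of_lt_of_le one_pos (one_le_btLog β)))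
  -- the pulled-back `g`
  have hgT : Measurable fun p : V => g (T p) := hg.comp hTm
  have hgTb : ∀ p : V, |g (T p)| ≤ Cg := fun p => hgb _
  have hgTS : ∀ p : V, p ∉ S → g (T p) = 0 := fun p hp => hgS _ (by rwa [← hmem])
  -- (1) the flat model
  have hFM := Mehler.flat_model_selfNormalised (E := gaugeModes L) ha hb hab hρ0 hρ hρ1 hγ hr0 hRpos hRr (powScale 1 β) ht hfit hεR hεS hgT hgTb hgTS
  -- (2) the change of density and kernel
  have hS : MeasurableSet S := Mehler.measurableSet_weightedBall (E := gaugeModes L) (flatScale L β) r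
  obtain ⟨hfin, -, hD₀m, hD₀pos, -, -⟩ := Mehler.weightedBall_mass (E := gaugeModes L) hγ hr0 hRpos hRr (powScale 1 β)
  haveI : IsFiniteMeasure ((volume : Measure V).restrict S) := isFiniteMeasure_restrict.2 hfin.ne
  obtain ⟨hG₀m, hG₀pos, hG₀b⟩ := flatKernel_data (L := L) hβ (powScale 1 β)
  obtain ⟨hG₁m, hG₁0, hG₁b⟩ := trueKernel_flat_data (L := L) hβ.le
  have hvc := vacCoef_pos (σ := StiffIdx L β)
  have hDrel : ∀ p : V, cD L β (T p) = fpWeightBar L (powScale 1 β) / vacCoef (StiffIdx L β) ^ 2 * (hR 0 p.1 ^ 2 * Real.exp (-(‖p.2‖ ^ 2 / powScale 1 β ^ 2))) := fun p => by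
    rw [hT, cD_flatMap hβ, Submodule.coe_norm]
  have hcD : 0 < fpWeightBar L (powScale 1 β) / vacCoef (StiffIdx L β) ^ 2 := div_pos (fpWeightBar_pos L (powScale_pos _ _)) (by positivity)
  have hA : 0 < vacCoef (StiffIdx L β) ^ 2 * Real.exp (2 * η) := by positivity
  have hB : 0 < Real.exp (2 * η) / vacCoef (StiffIdx L β) ^ 2 := by positivity
  have hker : ∀ p ∈ S, ∀ q ∈ S,
      hR 0 p.1 * mehlerKernel (flatA L β) (flatB L β) p.1 q.1 * hR 0 q.1 * (Real.exp (-(‖p.2‖ ^ 2 / powScale 1 β ^ 2)) * Real.exp (-(‖q.2‖ ^ 2 / powScale 1 β ^ 2))) ≤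
        vacCoef (StiffIdx L β) ^ 2 * Real.exp (2 * η) * (cΘ L β (T p) * cK L β (T p) (T q) * cΘ L β (T q)) ∧
      cΘ L β (T p) * cK L β (T p) (T q) * cΘ L β (T q) ≤
        Real.exp (2 * η) / vacCoef (StiffIdx L β) ^ 2 *
          (hR 0 p.1 * mehlerKernel (flatA L β) (flatB L β) p.1 q.1 * hR 0 q.1 * (Real.exp (-(‖p.2‖ ^ 2 / powScale 1 β ^ 2)) * Real.exp (-(‖q.2‖ ^ 2 / powScale 1 β ^ 2)))) := by
    intro p hp q hq
    obtain ⟨h1, h2⟩ := kernel_flatMap_two_sided (L := L) hβ hη ((hmem p).1 hp) ((hmem q).1 hq)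
    simp only [Submodule.norm_coe] at h1 h2
    have hvc2 : vacCoef (StiffIdx L β) ^ 2 ≠ 0 := by positivity
    have he : Real.exp (2 * η) * Real.exp (-(2 * η)) = 1 := by rw [← Real.exp_add]; simp
    constructor
    · -- `G ≤ vc²e^{2η}·G₁` from `e^{−2η}G/vc² ≤ G₁`
      have h3 := mul_le_mul_of_nonneg_left h1 hA.le
      rw [kernel_sandwich_aux hvc2 he] at h3
      exact h3
    · rw [kernel_sandwich_aux'] at h2
      exact h2
  -- `I₁ > 0` in flat coordinates
  have hI₁ : 0 < ∫ p in S, ∫ q in S, cΘ L β (T p) * cK L β (T p) (T q) * cΘ L β (T q) ∂volume ∂volume := by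
    have e : (fun x => ∫ y in cS L β, cΘ L β x * cK L β x y * cΘ L β y ∂(Measure.map T volume)) =
        fun x => ∫ q in (T : V → _) ⁻¹' cS L β, cΘ L β x * cK L β x (T q) * cΘ L β (T q) ∂volume := funext fun x => hTemb.setIntegral_map _ _
    rw [hT] at hIν ⊢; rw [e, hTemb.setIntegral_map, hpre] at hIν; exact hIν
  have hP : 0 ≤ 2 / (1 - ρ) := div_nonneg (by norm_num) (by linarith)
  have hK := StiffDoor.flat_kernel_change (m := (volume : Measure V)) hS
    (g := fun p : V => g (T p)) (D₀ := fun p : V => hR 0 p.1 ^ 2 * Real.exp (-(‖p.2‖ ^ 2 / powScale 1 β ^ 2))) (D₁ := fun p : V => cD L β (T p))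
    (G₀ := fun p q : V => hR 0 p.1 * mehlerKernel (flatA L β) (flatB L β) p.1 q.1 * hR 0 q.1 * (Real.exp (-(‖p.2‖ ^ 2 / powScale 1 β ^ 2)) * Real.exp (-(‖q.2‖ ^ 2 / powScale 1 β ^ 2))))
    (G₁ := fun p q : V => cΘ L β (T p) * cK L β (T p) (T q) * cΘ L β (T q))
    hgT hgTb hDrel hcD (fun p => (hD₀pos p).le) hG₀m hG₀b hG₁m hG₁b hG₁0 hA hB (fun p hp q hq => (hker p hp q hq).1) (fun p hp q hq => (hker p hp q hq).2) hI₁ hP hFM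
  obtain ⟨-, hK2⟩ := hK
  -- (3) push forward along `T`
  rw [← hpre] at hK2
  have h3 := hflat_map_of_pullback (L := L) (μ := (volume : Measure V)) hTemb (S := cS L β) (g := g) (D := cD L β)
    (J₀ := fun x y => cΘ L β x * cK L β x y * cΘ L β y *
      ((∫ z in (T : V → _) ⁻¹' cS L β, cD L β (T z) ∂volume) / ∫ z in (T : V → _) ⁻¹' cS L β, ∫ w in (T : V → _) ⁻¹' cS L β, cΘ L β (T z) * cK L β (T z) (T w) * cΘ L β (T w) ∂volume ∂volume))
    hK2
  -- (4) the normalisation constants in `ν`-form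
  have eZ : ∫ z in (T : V → _) ⁻¹' cS L β, cD L β (T z) ∂volume = ∫ z in cS L β, cD L β z ∂(Measure.map T volume) := (hTemb.setIntegral_map _ _).symm
  have eI : ∫ z in (T : V → _) ⁻¹' cS L β, ∫ w in (T : V → _) ⁻¹' cS L β, cΘ L β (T z) * cK L β (T z) (T w) * cΘ L β (T w) ∂volume ∂volume =
      ∫ z in cS L β, ∫ w in cS L β, cΘ L β z * cK L β z w * cΘ L β w ∂(Measure.map T volume) ∂(Measure.map T volume) := by
    have e : (fun z => ∫ w in cS L β, cΘ L β z * cK L β z w * cΘ L β w ∂(Measure.map T volume)) =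
        fun z => ∫ w in (T : V → _) ⁻¹' cS L β, cΘ L β z * cK L β z (T w) * cΘ L β (T w) ∂volume := funext fun z => hTemb.setIntegral_map _ _
    rw [e, hTemb.setIntegral_map]
  rw [eZ, eI] at h3
  rw [hT] at h3 ⊢
  exact h3

end Summit.QuantumFields.YangMills.Theorems.FemtoTransferGap.TwoLattice.ConstTube

end
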